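import Mathlib
import HarnessLib
import Summits.AtomisticToContinuum.FouriersLaw.Theses.JunctionLocality
import Literature.MathematicalPhysics.KineticTheory.LangevinChainGibbs
import Summits.AtomisticToContinuum.FouriersLaw.Theorems.JunctionLocalitySuperadditiveResistanceKuboFrame
import Summits.AtomisticToContinuum.FouriersLaw.Theorems.JunctionLocalitySuperadditiveResistanceKuboGauss
import Summits.AtomisticToContinuum.FouriersLaw.Theorems.JunctionLocalitySuperadditiveResistanceKuboPlain
import Summits.AtomisticToContinuum.FouriersLaw.Theorems.JunctionLocalitySuperadditiveResistanceTerminationIdentity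

/-!
# Termination locality III: the `N`-uniform end-gradient budget of the bare piece
(stub `stub_terminationLocalityTC` of line `thermalise-then-cut-probe-insertion`, crux
`JunctionLocality.SuperadditiveResistance`, stmt-AtomisticToContinuum-11748)

By the landed termination identity (`…TerminationIdentity`, p93070) the stub's left clause
`selfLeft g ≤ G_N(1 + cG_N)` is EQUIVALENT to an `N`-uniform one-sided bound on
`S_N + Dyn_N`, `Dyn_N = ⟨gb₁∘R, V'(r_J)(∂_{p_{N−1}} g_N)∘π_N⟩_{μ^{(N+M)}}`: the only place where the bare
`N`-piece's forward field `g_N` enters the dynamic term is its momentum gradient `∂_{p_{N−1}} g_N` at the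
γ-thermostatted end site. This file lands the EXACT and `N`-UNIFORM control of that gradient which the
tree's Kubo toolkit yields, registered as `helper_terminationEndGradient`. For every classical forward
field `g_N ∈ C² ∩ L²(μ_T^{(N)})` of the bare piece (`L_N^{T,T} g_N = −(p_0² − T)`; all integrals for `μ_T^{(N)}`):

* `plainField_dirichlet` — carré du champ / fluctuation–dissipation at the two bathed sites:
  `γT(‖∂_{p_0} g_N‖² + ‖∂_{p_{N−1}} g_N‖²) = ⟨g_N, p_0² − T⟩` (`Kubo.fluctuation_dissipation`);
* `plainField_endPairing` — the sum rule at the far end: `⟨g_N, p²_{N−1} − T⟩ = T²/γ − ⟨g_N, p_0² − T⟩`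
  (zero row sum of the plain `2 × 2` Kubo matrix, `sum_rule`);
* `plainField_projection` — Gaussian integration by parts in `p_{N−1}`:
  `⟨p_{N−1}, ∂_{p_{N−1}} g_N⟩ = (1/T)⟨g_N, p²_{N−1} − T⟩` (`Kubo.gauss_ibp`);
* `plainFrame_kuboLink` — along a plain frame `PlainFrame P T N h G`: `G = γ − (γ²/T²)⟨g_N, p_0² − T⟩`;
* `helper_terminationEndGradient` (registered) — under the stub's own hypotheses (crux frame + the pieces'
  plain Kubo frames, `G_N = D N/(N−1)`), for every `N ≥ 2` and every such `g_N`: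
  `⟨g_N, p_0² − T⟩ = (T²/γ²)(γ − G_N)`, `⟨g_N, p²_{N−1} − T⟩ = (T²/γ²)G_N`,
  `‖∂_{p_0} g_N‖² + ‖∂_{p_{N−1}} g_N‖² = (T/γ³)(γ − G_N)`, `⟨p_{N−1}, ∂_{p_{N−1}} g_N⟩ = (T/γ²)G_N`,
  the Pythagoras split `‖∂_{p_{N−1}} g_N − (G_N/γ²)p_{N−1}‖² = ‖∂_{p_{N−1}} g_N‖² − T G_N²/γ⁴`, and
  `0 < G_N ≤ γ`. CONSEQUENCE (`N`-UNIFORM): the end gradient entering `Dyn_N` has `L²(μ^{(N)})`-norm²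
  `< T/γ²` for all `N`, its component along `p_{N−1}` is EXACTLY `(G_N/γ²)p_{N−1}` (norm² `T G_N²/γ⁴ = O(G_N²)`),
  and only its fluctuating part `r_N ⟂ p_{N−1}` (norm² `≤ T/γ² − (T/γ³)G_N − TG_N²/γ⁴`) is not `O(G_N)`.
  The companion file `…StubTerminationLocalityTCPower` evaluates the `p_{N−1}`-component of `Dyn_N` exactly.

What is NOT here: any `N`-uniform bound on the static term `S_N` or on the fluctuating pairing
`⟨gb₁∘R, V'(r_J) r_N∘π_N⟩` — that is the stub's remaining content (`TerminationRemainderBound`).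
References: Eckmann–Pillet–Rey-Bellet, CMP 201 (1999) §3 (Green identities of the Langevin chain);
Rey-Bellet (2003) Rem. 4.4 and Kundu–Dhar–Narayan (2009) (open-system Kubo matrix). Standard axioms only.
-/

noncomputable section

open MeasureTheory Filter Topology ProbabilityTheory
open scoped ContDiff NNReal ENNReal
open Literature.MathematicalPhysics.KineticTheory.HeatConduction
open Summit.AtomisticToContinuum.FouriersLaw.Theorems.SuperadditiveResistance.DeviceLiouville
  (liouvilleOp bathOp deviceWeight kin_eq_sq deviceGenerator_eq generator_eq_liouvilleOp_add)
open Summit.AtomisticToContinuum.FouriersLaw.Theorems.SuperadditiveResistance.Kubo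
  (fluctuation_dissipation gauss_ibp memLp_partialP memLp_kinetic memLp_momentum partition_pos
    integrable_mul_mul_gibbsDensity integrable_sq_mul_gibbsDensity integral_sq_mul_gibbsDensity_eq)

namespace Summit.AtomisticToContinuum.FouriersLaw.Cruxes.SuperadditiveResistance.ThermaliseThenCutProbeInsertion

/-- Sums against the plain chain's bath weights `[i = 0] + [i = L−1]` pick out the two end sites
(for `L = 1` both are site `0`, counted twice). -/
theorem sum_bathWeight_mul {N : ℕ} (hN : 1 ≤ N) (F : Fin N → ℝ) :
    ∑ i, OscillatorChain.bathWeight N i * F i = F ⟨0, by omega⟩ + F ⟨N - 1, by omega⟩ := by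
  unfold OscillatorChain.bathWeight
  simp only [add_mul, Finset.sum_add_distrib, ite_mul, one_mul, zero_mul]
  have e0 : ∀ i : Fin N, (if i.val = 0 then F i else 0) = if i = ⟨0, by omega⟩ then F i else 0 := fun i => by
    by_cases hi : i = ⟨0, by omega⟩
    · subst hi; simp
    · have : i.val ≠ 0 := fun h => hi (Fin.ext h)
      simp [hi, this]
  have e1 : ∀ i : Fin N, (if i.val = N - 1 then F i else 0) = if i = ⟨N - 1, by omega⟩ then F i else 0 := fun i => by
    by_cases hi : i = ⟨N - 1, by omega⟩
    · subst hi; simp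
    · have : i.val ≠ N - 1 := fun h => hi (Fin.ext h)
      simp [hi, this]
  simp only [e0, e1, Finset.sum_ite_eq', Finset.mem_univ, if_true]

/-! ## The bare piece's forward field at its two bathed sites (fixed `N`, exact) -/

section PlainPiece

variable {ω₂ lam β γ : ℝ} {N : ℕ} {T : ℝ}

/-- **Carré du champ of the bare piece's forward field** (`N ≥ 1`, `ω₂ > 0`, `lam, β ≥ 0`, `γ, T > 0`):
for `g_N ∈ C² ∩ L²(μ_T^{(N)})` with `L_N^{T,T} g_N = −(p_0² − T)`,
`γT(‖∂_{p_0} g_N‖² + ‖∂_{p_{N−1}} g_N‖²)_{L²(μ_T^{(N)})} = ⟨g_N, p_0² − T⟩_{μ_T^{(N)}}` — the entropy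
production of the forward field sits at the two bathed momenta and equals its Kubo pairing
(`Kubo.fluctuation_dissipation`, normalised to the Gibbs probability measure). -/
theorem plainField_dirichlet (hω : 0 < ω₂) (hl : 0 ≤ lam) (hβ : 0 ≤ β) (hγ : 0 < γ) (hN : 1 ≤ N)
    (hT : 0 < T) {gN : PhaseSpace N → ℝ} (hgC : ContDiff ℝ 2 gN)
    (hgL2 : MemLp gN 2 ((pinnedChain ω₂ lam β γ).gibbsMeasure N T))
    (hgpde : ∀ y, (pinnedChain ω₂ lam β γ).generator N T T gN y = -(kin N 0 y - T)) :
    γ * T * ((∫ y, partialP ⟨0, by omega⟩ gN y ^ 2 ∂((pinnedChain ω₂ lam β γ).gibbsMeasure N T)) +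
        ∫ y, partialP ⟨N - 1, by omega⟩ gN y ^ 2 ∂((pinnedChain ω₂ lam β γ).gibbsMeasure N T)) =
      ∫ y, gN y * (kin N 0 y - T) ∂((pinnedChain ω₂ lam β γ).gibbsMeasure N T) := by
  set P := pinnedChain ω₂ lam β γ with hP
  have hpair : ∀ y, 1 * liouvilleOp P N gN y + γ * bathOp N (OscillatorChain.bathWeight N) T gN y =
      -(kin N 0 y - T) := by
    intro y
    rw [← hgpde y, generator_eq_liouvilleOp_add]
    have : P.γ = γ := rfl
    rw [this, one_mul]
  have hk : MemLp (fun y : PhaseSpace N => kin N 0 y - T) 2 (P.gibbsMeasure N T) := by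
    have e : (fun y : PhaseSpace N => kin N 0 y - T) = fun y => y.2 ⟨0, by omega⟩ ^ 2 - T := by
      funext y; rw [kin_eq_sq_line (show 0 < N by omega)]
    rw [e]; exact memLp_kinetic (γ := γ) hω hl hβ N hT ⟨0, by omega⟩
  have hB : ∀ i : Fin N, 0 ≤ OscillatorChain.bathWeight N i := fun i => by
    unfold OscillatorChain.bathWeight; split_ifs <;> norm_num
  have hFD := fluctuation_dissipation hω hl hβ N hT (OscillatorChain.bathWeight N) hB 1 hγ hgC hgL2 hk hpair
  rw [sum_bathWeight_mul hN] at hFD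
  rw [P.integral_gibbsMeasure, P.integral_gibbsMeasure, P.integral_gibbsMeasure, hFD]
  ring

/-- **Sum rule at the far end** (`β > 0`): `⟨g_N, p²_{N−1} − T⟩ = T²/γ − ⟨g_N, p_0² − T⟩` for `μ_T^{(N)}` —
the zero row sum of the plain chain's `2 × 2` Kubo matrix (`sum_rule`: energy balance of the forward
field against `H`, `⟨p_0² − T, H⟩ = T²`), normalised. -/
theorem plainField_endPairing (hω : 0 < ω₂) (hl : 0 ≤ lam) (hβ : 0 < β) (hγ : 0 < γ) (hN : 1 ≤ N)
    (hT : 0 < T) {gN : PhaseSpace N → ℝ} (hgC : ContDiff ℝ 2 gN)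
    (hgL2 : MemLp gN 2 ((pinnedChain ω₂ lam β γ).gibbsMeasure N T))
    (hgpde : ∀ y, (pinnedChain ω₂ lam β γ).generator N T T gN y = -(kin N 0 y - T)) :
    ∫ y, gN y * (kin N (N - 1) y - T) ∂((pinnedChain ω₂ lam β γ).gibbsMeasure N T) =
      T ^ 2 / γ - ∫ y, gN y * (kin N 0 y - T) ∂((pinnedChain ω₂ lam β γ).gibbsMeasure N T) := by
  set P := pinnedChain ω₂ lam β γ with hP
  have hsum := sum_rule hω hl hβ hγ (show 0 < N by omega) hT hgC hgL2 hgpde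
  have hZ : 0 < ∫ x, P.gibbsDensity N T x := partition_pos hω hl hβ.le N hT
  have hk0 : MemLp (fun y : PhaseSpace N => y.2 ⟨0, by omega⟩ ^ 2 - T) 2 (P.gibbsMeasure N T) :=
    memLp_kinetic (γ := γ) hω hl hβ.le N hT ⟨0, by omega⟩
  have hk1 : MemLp (fun y : PhaseSpace N => y.2 ⟨N - 1, by omega⟩ ^ 2 - T) 2 (P.gibbsMeasure N T) :=
    memLp_kinetic (γ := γ) hω hl hβ.le N hT ⟨N - 1, by omega⟩
  have hI0 : Integrable fun x => gN x * (x.2 ⟨0, by omega⟩ ^ 2 - T) * P.gibbsDensity N T x :=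
    integrable_mul_mul_gibbsDensity hω hl hβ.le γ N hT hgL2 hk0
  have hI1 : Integrable fun x => gN x * (x.2 ⟨N - 1, by omega⟩ ^ 2 - T) * P.gibbsDensity N T x :=
    integrable_mul_mul_gibbsDensity hω hl hβ.le γ N hT hgL2 hk1
  have hsplit : ∫ x, gN x * ((x.2 ⟨0, by omega⟩ ^ 2 - T) + (x.2 ⟨N - 1, by omega⟩ ^ 2 - T)) *
      P.gibbsDensity N T x = (∫ x, gN x * (x.2 ⟨0, by omega⟩ ^ 2 - T) * P.gibbsDensity N T x) +
        ∫ x, gN x * (x.2 ⟨N - 1, by omega⟩ ^ 2 - T) * P.gibbsDensity N T x := by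
    rw [← integral_add hI0 hI1]
    exact integral_congr_ae (ae_of_all _ fun x => by ring)
  rw [hsplit] at hsum
  rw [P.integral_gibbsMeasure, P.integral_gibbsMeasure]
  have e0 : ∫ x, gN x * (kin N 0 x - T) * P.gibbsDensity N T x =
      ∫ x, gN x * (x.2 ⟨0, by omega⟩ ^ 2 - T) * P.gibbsDensity N T x :=
    integral_congr_ae (ae_of_all _ fun x => by dsimp only; rw [kin_eq_sq_line (show 0 < N by omega)])
  have e1 : ∫ x, gN x * (kin N (N - 1) x - T) * P.gibbsDensity N T x =
      ∫ x, gN x * (x.2 ⟨N - 1, by omega⟩ ^ 2 - T) * P.gibbsDensity N T x :=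
    integral_congr_ae (ae_of_all _ fun x => by dsimp only; rw [kin_eq_sq_line (show N - 1 < N by omega)])
  rw [e0, e1]
  field_simp
  linear_combination hsum

/-- **The `p_{N−1}`-component of the end gradient**: `⟨p_{N−1}, ∂_{p_{N−1}} g_N⟩ = (1/T)⟨g_N, p²_{N−1} − T⟩`
for `μ_T^{(N)}` (Gaussian integration by parts `Kubo.gauss_ibp` in `p_{N−1}`; `∂_{p_{N−1}} g_N ∈ L²` by the
landed energy estimate `memLp_partialP_plainField`). -/
theorem plainField_projection (hω : 0 < ω₂) (hl : 0 ≤ lam) (hβ : 0 ≤ β) (hγ : 0 < γ) (hN : 1 ≤ N)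
    (hT : 0 < T) {gN : PhaseSpace N → ℝ} (hgC : ContDiff ℝ 2 gN)
    (hgL2 : MemLp gN 2 ((pinnedChain ω₂ lam β γ).gibbsMeasure N T))
    (hgpde : ∀ y, (pinnedChain ω₂ lam β γ).generator N T T gN y = -(kin N 0 y - T)) :
    ∫ y, y.2 ⟨N - 1, by omega⟩ * partialP ⟨N - 1, by omega⟩ gN y ∂((pinnedChain ω₂ lam β γ).gibbsMeasure N T) =
      1 / T * ∫ y, gN y * (kin N (N - 1) y - T) ∂((pinnedChain ω₂ lam β γ).gibbsMeasure N T) := by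
  set P := pinnedChain ω₂ lam β γ with hP
  have hdg := memLp_partialP_plainField hω hl hβ hγ hN hT hgC hgL2 hgpde
  have h := gauss_ibp hω hl hβ N hT ⟨N - 1, by omega⟩ (hgC.of_le (by norm_cast)) hgL2 hdg
  rw [P.integral_gibbsMeasure, P.integral_gibbsMeasure]
  have e1 : ∫ x, gN x * (kin N (N - 1) x - T) * P.gibbsDensity N T x =
      ∫ x, (x.2 ⟨N - 1, by omega⟩ ^ 2 - T) * gN x * P.gibbsDensity N T x :=
    integral_congr_ae (ae_of_all _ fun x => by dsimp only; rw [kin_eq_sq_line (show N - 1 < N by omega)]; ring)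
  rw [e1, h]
  have hP' : pinnedChain ω₂ lam β γ = P := rfl
  simp only [hP']
  field_simp

/-- **Kubo link along a plain frame**: if `PlainFrame P T N h G` (so `G = γ(1/2 − ⟨p_0² − T, h⟩)`), then for
every classical forward field `g_N` of the left bath `G = γ − (γ²/T²)⟨g_N, p_0² − T⟩_{μ_T^{(N)}}`
(`kuboPairing_responseField`). In the line `G = D N/(N−1)`. -/
theorem plainFrame_kuboLink (hω : 0 < ω₂) (hl : 0 ≤ lam) (hβ : 0 < β) (hγ : 0 < γ) (hN : 1 ≤ N)
    (hT : 0 < T) {h : PhaseSpace N → ℝ} {G : ℝ} (hPF : PlainFrame (pinnedChain ω₂ lam β γ) T N h G)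
    {gN : PhaseSpace N → ℝ} (hgC : ContDiff ℝ 2 gN)
    (hgL2 : MemLp gN 2 ((pinnedChain ω₂ lam β γ).gibbsMeasure N T))
    (hgpde : ∀ y, (pinnedChain ω₂ lam β γ).generator N T T gN y = -(kin N 0 y - T)) :
    G = γ - γ ^ 2 / T ^ 2 * ∫ y, gN y * (kin N 0 y - T) ∂((pinnedChain ω₂ lam β γ).gibbsMeasure N T) := by
  obtain ⟨hh, -, hG0⟩ := hPF
  rw [hG0, kuboPairing_responseField hω hl hβ hγ (show 0 < N by omega) hT hh hgC hgL2 hgpde]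
  have : (pinnedChain ω₂ lam β γ).γ = γ := rfl
  rw [this]
  ring

/-- `‖p_i‖²_{L²(μ_T)} = T` (equipartition, normalised form of `Kubo.integral_sq_mul_gibbsDensity_eq`). -/
theorem integral_sq_momentum (hω : 0 < ω₂) (hl : 0 ≤ lam) (hβ : 0 ≤ β) (hT : 0 < T) (i : Fin N) :
    ∫ y, y.2 i ^ 2 ∂((pinnedChain ω₂ lam β γ).gibbsMeasure N T) = T := by
  have hZ : 0 < ∫ x, (pinnedChain ω₂ lam β γ).gibbsDensity N T x := partition_pos hω hl hβ N hT
  rw [(pinnedChain ω₂ lam β γ).integral_gibbsMeasure, integral_sq_mul_gibbsDensity_eq hω hl hβ N hT i]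
  field_simp

/-- **Pythagoras for the projection onto `p_i`**: for `F ∈ L²(μ_T)` and `c : ℝ`,
`‖F − c p_i‖² = ‖F‖² − 2c⟨p_i, F⟩ + c²T`. -/
theorem integral_sub_proj_sq (hω : 0 < ω₂) (hl : 0 ≤ lam) (hβ : 0 ≤ β) (hT : 0 < T) (i : Fin N)
    {F : PhaseSpace N → ℝ} (hF : MemLp F 2 ((pinnedChain ω₂ lam β γ).gibbsMeasure N T)) (c : ℝ) :
    ∫ y, (F y - c * y.2 i) ^ 2 ∂((pinnedChain ω₂ lam β γ).gibbsMeasure N T) =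
      (∫ y, F y ^ 2 ∂((pinnedChain ω₂ lam β γ).gibbsMeasure N T)) -
        2 * c * (∫ y, y.2 i * F y ∂((pinnedChain ω₂ lam β γ).gibbsMeasure N T)) + c ^ 2 * T := by
  set μ := (pinnedChain ω₂ lam β γ).gibbsMeasure N T with hμ
  have hp : MemLp (fun y : PhaseSpace N => y.2 i) 2 μ := memLp_momentum hω hl hβ N hT i
  have hI1 : Integrable (fun y => F y ^ 2) μ := hF.integrable_sq
  have hI2 : Integrable (fun y => y.2 i * F y) μ := hp.integrable_mul hF
  have hI3 : Integrable (fun y : PhaseSpace N => y.2 i ^ 2) μ := hp.integrable_sq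
  have hI4 : Integrable (fun y => F y ^ 2 - 2 * c * (y.2 i * F y)) μ := hI1.sub (hI2.const_mul (2 * c))
  have hI5 : Integrable (fun y : PhaseSpace N => c ^ 2 * y.2 i ^ 2) μ := hI3.const_mul (c ^ 2)
  have hI6 : Integrable (fun y : PhaseSpace N => 2 * c * (y.2 i * F y)) μ := hI2.const_mul (2 * c)
  have e : (fun y => (F y - c * y.2 i) ^ 2) = fun y => (F y ^ 2 - 2 * c * (y.2 i * F y)) + c ^ 2 * y.2 i ^ 2 := by
    funext y; ring
  rw [e, integral_add hI4 hI5, integral_sub hI1 hI6, integral_const_mul, integral_const_mul,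
    integral_sq_momentum hω hl hβ hT i]

end PlainPiece

/-! ## The registered helper: the `N`-uniform end-gradient budget under the stub's hypotheses -/

/-- **Registered helper `helper_terminationEndGradient` (toward `stub_terminationLocalityTC`).** Under the
stub's own hypotheses — the crux frame and the pieces' plain Kubo frames with `G_L = D L/(L−1)` — for every
`N ≥ 2` and every classical forward field `g_N ∈ C² ∩ L²(μ_T^{(N)})` of the bare `N`-piece's left bath
(`L_N^{T,T} g_N = −(p_0² − T)`; one exists by the landed `stub_plainForwardField`), with all pairings and
norms for `μ_T^{(N)}` and `G_N := D N/(N−1)`: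
(1) `⟨g_N, p_0² − T⟩ = (T²/γ²)(γ − G_N)`; (2) `⟨g_N, p²_{N−1} − T⟩ = (T²/γ²)G_N`;
(3) `‖∂_{p_0} g_N‖² + ‖∂_{p_{N−1}} g_N‖² = (T/γ³)(γ − G_N)`; (4) `⟨p_{N−1}, ∂_{p_{N−1}} g_N⟩ = (T/γ²)G_N`;
(5) `‖∂_{p_{N−1}} g_N − (G_N/γ²)p_{N−1}‖² = ‖∂_{p_{N−1}} g_N‖² − T G_N²/γ⁴`; (6) `0 < G_N ≤ γ`.
Hence, UNIFORMLY IN `N`: the end gradient of the bare field that drives the dynamic termination remainder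
`Dyn_N` has squared norm `< T/γ²`, its mean part along `p_{N−1}` is exactly `(G_N/γ²)p_{N−1}` (squared norm
`T G_N²/γ⁴ = O(G_N²)`), and its fluctuating part `r_N ⟂ p_{N−1}` has squared norm `≤ T/γ² − (T/γ³)G_N − TG_N²/γ⁴`. -/
theorem helper_terminationEndGradient : ∀ (ω₂ lam β γ : ℝ) (μ : (N : ℕ) → ℝ → ℝ → Measure (PhaseSpace N)) (T : ℝ) (D : ℕ → ℝ), CruxFrame ω₂ lam β γ μ T D → (∀ L : ℕ, 2 ≤ L → ∃ h : PhaseSpace L → ℝ, PlainFrame (pinnedChain ω₂ lam β γ) T L h (D L / ((L : ℝ) - 1))) → ∀ (N : ℕ) (hN : 2 ≤ N) (gN : PhaseSpace N → ℝ), ContDiff ℝ 2 gN → MemLp gN 2 ((pinnedChain ω₂ lam β γ).gibbsMeasure N T) → (∀ y, (pinnedChain ω₂ lam β γ).generator N T T gN y = -(kin N 0 y - T)) → (∫ y, gN y * (kin N 0 y - T) ∂((pinnedChain ω₂ lam β γ).gibbsMeasure N T)) = T ^ 2 / γ ^ 2 * (γ - D N / ((N : ℝ) - 1)) ∧ (∫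 y, gN y * (kin N (N - 1) y - T) ∂((pinnedChain ω₂ lam β γ).gibbsMeasure N T)) = T ^ 2 / γ ^ 2 * (D N / ((N : ℝ) - 1)) ∧ (∫ y, partialP ⟨0, by omega⟩ gN y ^ 2 ∂((pinnedChain ω₂ lam β γ).gibbsMeasure N T)) + (∫ y, partialP ⟨N - 1, by omega⟩ gN y ^ 2 ∂((pinnedChain ω₂ lam β γ).gibbsMeasure N T)) = T / γ ^ 3 * (γ - D N / ((N : ℝ) - 1)) ∧ (∫ y, y.2 ⟨N - 1, by omega⟩ * partialP ⟨N - 1, by omega⟩ gN y ∂((pinnedChain ω₂ lam β γ).gibbsMeasure N T)) = T / γ ^ 2 * (D N / ((N : ℝ) - 1)) ∧ (∫ y, (partialP ⟨N - 1, by omega⟩ gN y - (D N / ((N : ℝ) - 1)) / γ ^ 2 * y.2 ⟨N - 1, by omega⟩) ^ 2 ∂((pinnedChain ω₂ lam β γ).gibbsMeasure N T)) = (∫ y, partialP ⟨N - 1, by omega⟩ gN y ^ 2 ∂((pinnedChain ω₂ lam β γ).gibbsMeasure N T)) - T * (D N / ((N : ℝ) - 1)) ^ 2 / γ ^ 4 ∧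 0 < D N / ((N : ℝ) - 1) ∧ D N / ((N : ℝ) - 1) ≤ γ := by
  intro ω₂ lam β γ μ T D hF hPlain N hN gN hgC hgL2 hgpde
  obtain ⟨hω, hlam, hβ, hγ, -, -, hT, -, hpos⟩ := hF
  obtain ⟨h, hPF⟩ := hPlain N hN
  set G := D N / ((N : ℝ) - 1) with hG
  have hN1 : (1 : ℕ) ≤ N := by omega
  have hlink := plainFrame_kuboLink hω hlam.le hβ hγ hN1 hT hPF hgC hgL2 hgpde
  have hdir := plainField_dirichlet hω hlam.le hβ.le hγ hN1 hT hgC hgL2 hgpde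
  have hend := plainField_endPairing hω hlam.le hβ hγ hN1 hT hgC hgL2 hgpde
  have hproj := plainField_projection hω hlam.le hβ.le hγ hN1 hT hgC hgL2 hgpde
  have hdg := memLp_partialP_plainField hω hlam.le hβ.le hγ hN1 hT hgC hgL2 hgpde
  have hpyth := integral_sub_proj_sq (γ := γ) hω hlam.le hβ.le hT ⟨N - 1, by omega⟩ hdg (G / γ ^ 2)
  have hγ0 : γ ≠ 0 := hγ.ne'
  have hT0 : T ≠ 0 := hT.ne'
  have h1 : ∫ y, gN y * (kin N 0 y - T) ∂((pinnedChain ω₂ lam β γ).gibbsMeasure N T) = T ^ 2 / γ ^ 2 * (γ - G) := by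
    rw [hlink]; field_simp; ring
  have h2 : ∫ y, gN y * (kin N (N - 1) y - T) ∂((pinnedChain ω₂ lam β γ).gibbsMeasure N T) = T ^ 2 / γ ^ 2 * G := by
    rw [hend, h1]; field_simp; ring
  have h3 : (∫ y, partialP ⟨0, by omega⟩ gN y ^ 2 ∂((pinnedChain ω₂ lam β γ).gibbsMeasure N T)) +
      (∫ y, partialP ⟨N - 1, by omega⟩ gN y ^ 2 ∂((pinnedChain ω₂ lam β γ).gibbsMeasure N T)) =
      T / γ ^ 3 * (γ - G) := by
    apply mul_left_cancel₀ (mul_ne_zero hγ0 hT0)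
    rw [hdir, h1]; field_simp
  have h4 : ∫ y, y.2 ⟨N - 1, by omega⟩ * partialP ⟨N - 1, by omega⟩ gN y ∂((pinnedChain ω₂ lam β γ).gibbsMeasure N T) =
      T / γ ^ 2 * G := by
    rw [hproj, h2]; field_simp
  have hGpos : 0 < G := by
    have hN' : (2 : ℝ) ≤ (N : ℝ) := by exact_mod_cast hN
    exact div_pos (hpos N hN) (by linarith)
  refine ⟨h1, h2, h3, h4, ?_, hGpos, ?_⟩
  · rw [hpyth, h4]; field_simp; ring
  · have hA : 0 ≤ ∫ y, partialP ⟨0, by omega⟩ gN y ^ 2 ∂((pinnedChain ω₂ lam β γ).gibbsMeasure N T) :=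
      integral_nonneg fun _ => sq_nonneg _
    have hB : 0 ≤ ∫ y, partialP ⟨N - 1, by omega⟩ gN y ^ 2 ∂((pinnedChain ω₂ lam β γ).gibbsMeasure N T) :=
      integral_nonneg fun _ => sq_nonneg _
    have hsum : 0 ≤ T / γ ^ 3 * (γ - G) := by rw [← h3]; exact add_nonneg hA hB
    have hc : 0 < T / γ ^ 3 := by positivity
    nlinarith

end Summit.AtomisticToContinuum.FouriersLaw.Cruxes.SuperadditiveResistance.ThermaliseThenCutProbeInsertion

end
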